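import Mathlib.RingTheory.AdicCompletion.LocalRing
import Mathlib.RingTheory.LocalRing.ResidueField.Basic
import Mathlib.RingTheory.Noetherian.Basic
import Mathlib.LinearAlgebra.Matrix.GeneralLinearGroup.Defs
import HarnessLib

/-!
# Complete Noetherian local rings with finite residue field: finite levels and limits

Two pieces of folklore commutative algebra used to build continuous representations with values in
a complete Noetherian local ring `R` with finite residue field (the universal unramified framed
deformation, `UnramifiedFrameLift`):

* `finite_quotient_maximalIdeal_pow` — **`R/𝔪ᵐ` is finite for every `m`** (induction: the kernel
  `𝔪ᵐ/𝔪ᵐ⁺¹` of `R/𝔪ᵐ⁺¹ → R/𝔪ᵐ` is spanned over the finite field `R/𝔪` by finitely many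
  generators of `𝔪ᵐ`); hence `GL_n(R/𝔪ᵐ)` is a finite group (`finite_generalLinearGroup_quotient`).
* `existsUnique_forall_mk_eq` — **limits of compatible families**: for `R` `𝔪`-adically complete, a
  family `y m ∈ R/𝔪ᵐ` compatible under the transition maps comes from a unique `x ∈ R`
  (`IsPrecomplete` + `IsHausdorff`); `limOfCompatible` names it.

No named facts, no `sorry`.

## References

* H. Matsumura, *Commutative Ring Theory*, CUP 1986, §8 (completions). [Matsumura1987]
-/

noncomputable section

open IsLocalRing

namespace Literature.NumberTheory.GaloisRepresentations

namespace CompleteLocalRing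

variable {R : Type*} [CommRing R]

/-! ### Finiteness of the levels `R/𝔪ᵐ` -/

section Finite

variable [IsLocalRing R] [IsNoetherianRing R]

omit [IsNoetherianRing R] in
/-- The kernel of `R/𝔪ᵐ⁺¹ → R/𝔪ᵐ` is covered by combinations of generators of `𝔪ᵐ` with
coefficients lifted from the residue field. [folklore] -/
theorem exists_eq_sum_of_factor_eq_zero {m : ℕ} {s : Finset R} (hs : Ideal.span (s : Set R) = maximalIdeal R ^ m)
    (lift : ResidueField R → R) (hlift : ∀ c, residue R (lift c) = c)
    (z : R ⧸ maximalIdeal R ^ (m + 1))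
    (hz : Ideal.Quotient.factor (Ideal.pow_le_pow_right (Nat.le_succ m)) z = 0) :
    ∃ c : s → ResidueField R,
      z = ∑ g : s, Ideal.Quotient.mk (maximalIdeal R ^ (m + 1)) (lift (c g) * (g : R)) := by
  classical
  obtain ⟨y, rfl⟩ := Ideal.Quotient.mk_surjective z
  rw [Ideal.Quotient.factor_mk, Ideal.Quotient.eq_zero_iff_mem, ← hs, Submodule.mem_span_finset] at hz
  obtain ⟨f, -, hf⟩ := hz
  refine ⟨fun g => residue R (f g), ?_⟩
  rw [← map_sum, Ideal.Quotient.eq, ← hf, ← Finset.sum_coe_sort s (fun g => f g • g), ← Finset.sum_sub_distrib]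
  refine Ideal.sum_mem _ fun g _ => ?_
  rw [smul_eq_mul, ← sub_mul, pow_succ']
  refine Ideal.mul_mem_mul ?_ ?_
  · show f g - lift (residue R (f g)) ∈ maximalIdeal R
    rw [← IsLocalRing.residue_eq_zero_iff, map_sub, hlift, sub_self]
  · have hg : (g : R) ∈ Ideal.span (s : Set R) := Ideal.subset_span g.2
    rwa [hs] at hg

/-- **`R/𝔪ᵐ` is finite** for a Noetherian local ring with finite residue field. [folklore] -/
theorem finite_quotient_maximalIdeal_pow [Finite (ResidueField R)] (m : ℕ) :
    Finite (R ⧸ maximalIdeal R ^ m) := by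
  classical
  induction m with
  | zero =>
    rw [pow_zero, Ideal.one_eq_top]
    haveI : Subsingleton (R ⧸ (⊤ : Ideal R)) := Ideal.Quotient.subsingleton_iff.2 rfl
    infer_instance
  | succ m ih =>
    haveI := ih
    obtain ⟨s, hs⟩ := (IsNoetherian.noetherian (maximalIdeal R ^ m))
    -- a set-theoretic section of the residue map and of `R/𝔪ᵐ⁺¹ → R/𝔪ᵐ`
    let lift : ResidueField R → R := fun c => (residue_surjective c).choose
    have hlift : ∀ c, residue R (lift c) = c := fun c => (residue_surjective c).choose_spec
    let π : R ⧸ maximalIdeal R ^ (m + 1) →+* R ⧸ maximalIdeal R ^ m :=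
      Ideal.Quotient.factor (Ideal.pow_le_pow_right (Nat.le_succ m))
    have hπ : Function.Surjective π := Ideal.Quotient.factor_surjective _
    let sec : R ⧸ maximalIdeal R ^ m → R ⧸ maximalIdeal R ^ (m + 1) := fun y => (hπ y).choose
    have hsec : ∀ y, π (sec y) = y := fun y => (hπ y).choose_spec
    let F : (R ⧸ maximalIdeal R ^ m) × (s → ResidueField R) → R ⧸ maximalIdeal R ^ (m + 1) :=
      fun yc => sec yc.1 + ∑ g : s, Ideal.Quotient.mk (maximalIdeal R ^ (m + 1)) (lift (yc.2 g) * (g : R))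
    refine Finite.of_surjective F fun x => ?_
    have hker : π (x - sec (π x)) = 0 := by rw [map_sub, hsec, sub_self]
    obtain ⟨c, hc⟩ := exists_eq_sum_of_factor_eq_zero hs lift hlift _ hker
    exact ⟨(π x, c), by simp only [F]; rw [← hc, add_sub_cancel]⟩

/-- `GL_n(R/𝔪ᵐ)` is finite. [folklore] -/
theorem finite_generalLinearGroup_quotient [Finite (ResidueField R)] (m : ℕ) (ι : Type*) [Fintype ι]
    [DecidableEq ι] : Finite (GL ι (R ⧸ maximalIdeal R ^ m)) := by
  haveI := finite_quotient_maximalIdeal_pow (R := R) m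
  infer_instance

end Finite

/-! ### Limits of compatible families in a complete local ring -/

section Limits

variable (I : Ideal R) [IsAdicComplete I R]

/-- **Limits of compatible families**: in an `I`-adically complete ring, a family
`y m ∈ R/Iᵐ` with `y m = y (m+1) mod Iᵐ` is the reduction of a unique element of `R`.
[cite: Matsumura1987, §8] -/
theorem existsUnique_forall_mk_eq (y : ∀ m : ℕ, R ⧸ I ^ m)
    (hy : ∀ m, Ideal.Quotient.factor (Ideal.pow_le_pow_right (Nat.le_succ m)) (y (m + 1)) = y m) :
    ∃! x : R, ∀ m, Ideal.Quotient.mk (I ^ m) x = y m := by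
  -- compatible in the general form
  have hy' : ∀ {m k : ℕ} (h : m ≤ k), Ideal.Quotient.factor (Ideal.pow_le_pow_right h) (y k) = y m := by
    intro m k h
    induction k, h using Nat.le_induction with
    | base => obtain ⟨z, hz⟩ := Ideal.Quotient.mk_surjective (y m); rw [← hz, Ideal.Quotient.factor_mk]
    | succ k hmk ih =>
      rw [← ih, ← hy k]
      obtain ⟨z, hz⟩ := Ideal.Quotient.mk_surjective (y (k + 1))
      rw [← hz, Ideal.Quotient.factor_mk, Ideal.Quotient.factor_mk, Ideal.Quotient.factor_mk]
  -- representatives form a Cauchy sequence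
  let f : ℕ → R := fun m => (Ideal.Quotient.mk_surjective (y m)).choose
  have hf : ∀ m, Ideal.Quotient.mk (I ^ m) (f m) = y m := fun m => (Ideal.Quotient.mk_surjective (y m)).choose_spec
  have hsmod : ∀ {m : ℕ} {a b : R}, a ≡ b [SMOD (I ^ m • ⊤ : Submodule R R)] ↔ a - b ∈ I ^ m := by
    intro m a b
    rw [SModEq.sub_mem, smul_eq_mul, Ideal.mul_top]
  have hcauchy : ∀ {m k : ℕ}, m ≤ k → f m ≡ f k [SMOD (I ^ m • ⊤ : Submodule R R)] := by
    intro m k hmk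
    rw [hsmod, ← Ideal.Quotient.eq, hf m, ← hy' hmk, ← hf k, Ideal.Quotient.factor_mk]
  obtain ⟨x, hx⟩ := IsPrecomplete.prec (IsAdicComplete.toIsPrecomplete (I := I) (M := R)) hcauchy
  refine ⟨x, fun m => ?_, fun x' hx' => ?_⟩
  · have h := (hsmod.1 (hx m))
    rw [← hf m, eq_comm, Ideal.Quotient.eq]
    exact h
  · have hxx' : ∀ m, x' - x ∈ I ^ m := fun m => by
      rw [← Ideal.Quotient.eq, hx' m, ← hf m, Ideal.Quotient.eq]
      exact hsmod.1 (hx m)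
    have := IsHausdorff.haus (IsAdicComplete.toIsHausdorff (I := I) (M := R)) (x' - x) fun m => by
      rw [SModEq.zero, smul_eq_mul, Ideal.mul_top]; exact hxx' m
    exact (sub_eq_zero.1 this)

/-- The limit of a compatible family. [folklore] -/
def limOfCompatible (y : ∀ m : ℕ, R ⧸ I ^ m)
    (hy : ∀ m, Ideal.Quotient.factor (Ideal.pow_le_pow_right (Nat.le_succ m)) (y (m + 1)) = y m) : R :=
  (existsUnique_forall_mk_eq I y hy).choose

/-- The limit reduces to the given family. [folklore] -/
theorem mk_limOfCompatible (y : ∀ m : ℕ, R ⧸ I ^ m)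
    (hy : ∀ m, Ideal.Quotient.factor (Ideal.pow_le_pow_right (Nat.le_succ m)) (y (m + 1)) = y m) (m : ℕ) :
    Ideal.Quotient.mk (I ^ m) (limOfCompatible I y hy) = y m :=
  (existsUnique_forall_mk_eq I y hy).choose_spec.1 m

/-- **Uniqueness**: an element is determined by all its reductions (`R` is `I`-adically separated).
[folklore] -/
theorem eq_of_forall_mk_eq {x x' : R} (h : ∀ m : ℕ, Ideal.Quotient.mk (I ^ m) x = Ideal.Quotient.mk (I ^ m) x') :
    x = x' := by
  have h1 := (existsUnique_forall_mk_eq I (fun m => Ideal.Quotient.mk (I ^ m) x') (fun m => by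
    rw [Ideal.Quotient.factor_mk])).unique (y₁ := x) (y₂ := x') h (fun _ => rfl)
  exact h1

end Limits

end CompleteLocalRing

end Literature.NumberTheory.GaloisRepresentations

end
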